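import Summits.SmoothPoincare4.SmoothPoincare4.Theorems.CongruenceShadowsNormalFormStablyTrivialSketchPosition

/-!
# Crux `NormalFormStablyTrivial` (stmt-SmoothPoincare4-14591), line `Sketch`: Nielsen-free level
descent under the route's own `WaldhausenPairs`

Line `Sketch`, lead c2 (cycle 4), `--supports stmt-SmoothPoincare4-14591`.

The standing disprover's work file (`Cruxes/NormalFormStablyTrivial/Disproof.lean` §7,
`level_down_of_nielsen`, `normalFormStablyTrivial_of_eventually_of_nielsen`) proves that the crux at
level `m + 1` implies the crux at level `m` — so that provers may work in the asymptotic regime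
`g = 3 + 3m ≫ 0` and refuters gain nothing from small `m` — but only MODULO the tree's Nielsen
lifting hypothesis `hN` (every automorphism of `S_g` lifts to `F_{2g}` fixing the relator up to
conjugacy/inversion; Nielsen 1927, not proved in tree), because the normal-form hypothesis
`PairsStandard` ascends along a stabilisation only through `iso_stabilize_map_of_lift`.

This file removes the Nielsen gap ON THE ROUTE'S OWN TERMS: granted the route's rank-2 crux
`WaldhausenPairs` (item 14592: every balanced group trisection of `{1}` IS in normal form) the
normal-form hypothesis is free at every level, so the crux at level `m` is the `k = m + 1` slice of
Abrams–Gay–Kirby's condition `X` (`agkCondition_succ_of_level` / `level_of_agkCondition_succ`),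
and `X` is downward closed in `k` by stabilisation alone (`agkCondition_downward`,
`AgkCor6Sufficiency/Negative/DownwardClosed.lean`).  Consequences, all Nielsen-free:

* `level_down_of_waldhausenPairs` — `W ⊢ crux_{m+1} → crux_m`;
* `normalFormStablyTrivial_of_frequently` — `W ⊢ (∀ m₀ ∃ m ≥ m₀, crux_m) → crux` (registered
  helper of the line): the crux is equivalent to its EVENTUAL / FREQUENT form;
* `normalFormStablyTrivial_iff_eventually` — `W ⊢ crux ↔ ∀ m ≥ m₀, crux_m`, for every `m₀`.

Here `crux_m` is the level-`m` slice of the route decl, spelled out verbatim (the route file has no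
name for it).  Position of the line is unchanged: both registered stubs K1/K2 are open problems with
exactly the crux's strength (`stubs_iff_normalFormStablyTrivial`, SketchPosition.lean).

References: A. Abrams, D. Gay, R. Kirby, *Group trisections and smooth 4-manifolds*, Geom. Topol.
22 (2018), Def. 3 and Cor. 6; J. Nielsen, Acta Math. 50 (1927) (the hypothesis avoided here).
-/

noncomputable section

-- the prescribed namespace `Summit.<P>.<Sub>.…` duplicates `SmoothPoincare4` (P = Sub)
set_option linter.dupNamespace false

namespace Summit.SmoothPoincare4.SmoothPoincare4.Theorems.NormalFormStablyTrivial.Sketch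

open Literature.Topology.FourManifolds Subgroup
open Summit.SmoothPoincare4.SmoothPoincare4.Theses.CongruenceShadows
  (NormalFormStablyTrivial WaldhausenPairs)
open Summit.SmoothPoincare4.SmoothPoincare4.Theorems.AgkCor6Sufficiency.Negative
  (isStablyTrivial_of_stabilizeIter agkCondition_downward agkCondition_of_frequently)

/-- **`W ⊢ crux_m ⇒ X_{m+1}`.**  Granted `WaldhausenPairs`, the crux at level `m` (normalised
`(3+3m, m+1)` group trisections of `{1}` are stably trivial) gives Abrams–Gay–Kirby's condition at
`k = m + 1` (ALL `(3(m+1), m+1)` group trisections of `{1}` are stably trivial): transport along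
`3 (m + 1) = 3 + 3 m` by `subst` on a generalised genus and normalise the pairs by `W`.
[cite: AbramsGayKirby2018, Cor. 6] -/
theorem agkCondition_succ_of_level (hW : WaldhausenPairs) {m : ℕ}
    (h : ∀ K : TrisectionKernels (3 + 3 * m), IsGroupTrisection (3 + 3 * m) (m + 1) (PUnit : Type) K →
      (∀ i j : Fin 3, i ≠ j → ∃ α : SurfaceGroup (3 + 3 * m) ≃* SurfaceGroup (3 + 3 * m),
        (s4Kernels.stabilizeIter m i).map α.toMonoidHom = K i ∧
        (s4Kernels.stabilizeIter m j).map α.toMonoidHom = K j) → K.IsStablyTrivial)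
    (K : TrisectionKernels (3 * (m + 1))) (hK : IsGroupTrisection (3 * (m + 1)) (m + 1) (PUnit : Type) K) :
    K.IsStablyTrivial := by
  have key : ∀ (g : ℕ) (K' : TrisectionKernels g), g = 3 + 3 * m →
      IsGroupTrisection g (m + 1) (PUnit : Type) K' → K'.IsStablyTrivial := by
    intro g K' hg hK'
    subst hg
    exact h K' hK' (hW m K' hK')
  exact key (3 * (m + 1)) K (by ring) hK

/-- **`X_{m+1} ⇒ crux_m`, even without the normal-form hypothesis** (no `W` needed): transport
along `3 + 3 m = 3 (m + 1)`. [cite: AbramsGayKirby2018, Cor. 6] -/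
theorem level_of_agkCondition_succ {m : ℕ}
    (hX : ∀ K : TrisectionKernels (3 * (m + 1)), IsGroupTrisection (3 * (m + 1)) (m + 1) (PUnit : Type) K →
      K.IsStablyTrivial)
    (K : TrisectionKernels (3 + 3 * m)) (hK : IsGroupTrisection (3 + 3 * m) (m + 1) (PUnit : Type) K) :
    K.IsStablyTrivial := by
  have key : ∀ (g : ℕ) (K' : TrisectionKernels g), g = 3 * (m + 1) →
      IsGroupTrisection g (m + 1) (PUnit : Type) K' → K'.IsStablyTrivial := by
    intro g K' hg hK'
    subst hg
    exact hX K' hK'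
  exact key (3 + 3 * m) K (by ring) hK

/-- **LEVEL DESCENT, Nielsen-free, under `WaldhausenPairs`.**  The crux at level `m + 1` implies
the crux at level `m`: stabilise once (`stabilize_isGroupTrisection_holds`; the normal form of the
stabilised triple comes from `W`, not from lifting the pair automorphisms), apply level `m + 1`,
and let stable triviality descend (`isStablyTrivial_of_stabilizeIter`).  Compare
`Disproof.lean §7 level_down_of_nielsen`, which needs the Nielsen lifting hypothesis instead of `W`.
[cite: AbramsGayKirby2018, Def. 3 and Cor. 6] -/
theorem level_down_of_waldhausenPairs (hW : WaldhausenPairs) {m : ℕ}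
    (h : ∀ K : TrisectionKernels (3 + 3 * (m + 1)),
      IsGroupTrisection (3 + 3 * (m + 1)) (m + 1 + 1) (PUnit : Type) K →
      (∀ i j : Fin 3, i ≠ j → ∃ α : SurfaceGroup (3 + 3 * (m + 1)) ≃* SurfaceGroup (3 + 3 * (m + 1)),
        (s4Kernels.stabilizeIter (m + 1) i).map α.toMonoidHom = K i ∧
        (s4Kernels.stabilizeIter (m + 1) j).map α.toMonoidHom = K j) → K.IsStablyTrivial)
    (K : TrisectionKernels (3 + 3 * m)) (hK : IsGroupTrisection (3 + 3 * m) (m + 1) (PUnit : Type) K) :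
    K.IsStablyTrivial :=
  have hK' : IsGroupTrisection (3 + 3 * (m + 1)) (m + 1 + 1) (PUnit : Type) K.stabilize :=
    stabilize_isGroupTrisection_holds _ _ _ _ hK
  isStablyTrivial_of_stabilizeIter K 1 (h K.stabilize hK' (hW (m + 1) K.stabilize hK'))

/-- **FREQUENT FORM SUFFICES (registered helper of line `Sketch`).**  Granted `WaldhausenPairs`,
if for every `m₀` the crux holds at SOME level `m ≥ m₀`, then the crux holds: each such level gives
AGK's condition at `k = m + 1` (`agkCondition_succ_of_level`), AGK's condition is downward closed in
`k` (`agkCondition_of_frequently`), and `X ⇒ crux` through the line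
(`normalFormStablyTrivial_of_agkCondition`).  So, on the route's own terms and without the Nielsen
lifting hypothesis, provers of this crux may assume `g = 3 + 3m ≫ 0`, and no refutation can come
from small `m` unless the witness persists at infinitely many levels. [cite: AbramsGayKirby2018, Cor. 6] -/
theorem normalFormStablyTrivial_of_frequently (hW : WaldhausenPairs)
    (h : ∀ m₀ : ℕ, ∃ m, m₀ ≤ m ∧ ∀ K : TrisectionKernels (3 + 3 * m),
      IsGroupTrisection (3 + 3 * m) (m + 1) (PUnit : Type) K →
      (∀ i j : Fin 3, i ≠ j → ∃ α : SurfaceGroup (3 + 3 * m) ≃* SurfaceGroup (3 + 3 * m),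
        (s4Kernels.stabilizeIter m i).map α.toMonoidHom = K i ∧
        (s4Kernels.stabilizeIter m j).map α.toMonoidHom = K j) → K.IsStablyTrivial) :
    NormalFormStablyTrivial := by
  refine normalFormStablyTrivial_of_agkCondition (agkCondition_of_frequently fun k₀ => ?_)
  obtain ⟨m, hm, hlev⟩ := h k₀
  exact ⟨m + 1, by omega, agkCondition_succ_of_level hW hlev⟩

/-- **EVENTUAL FORM ⇔ crux**, for every threshold `m₀`, granted `WaldhausenPairs`. [cite: AbramsGayKirby2018, Cor. 6] -/
theorem normalFormStablyTrivial_iff_eventually (hW : WaldhausenPairs) (m₀ : ℕ) :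
    NormalFormStablyTrivial ↔ ∀ m, m₀ ≤ m → ∀ K : TrisectionKernels (3 + 3 * m),
      IsGroupTrisection (3 + 3 * m) (m + 1) (PUnit : Type) K →
      (∀ i j : Fin 3, i ≠ j → ∃ α : SurfaceGroup (3 + 3 * m) ≃* SurfaceGroup (3 + 3 * m),
        (s4Kernels.stabilizeIter m i).map α.toMonoidHom = K i ∧
        (s4Kernels.stabilizeIter m j).map α.toMonoidHom = K j) → K.IsStablyTrivial :=
  ⟨fun hX m _ K hK hP => hX m K hK hP,
    fun h => normalFormStablyTrivial_of_frequently hW fun m₁ =>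
      ⟨max m₀ m₁, le_max_right _ _, h _ (le_max_left _ _)⟩⟩

/-- **The crux at infinitely many levels ⇔ AGK's condition `X`**, granted `WaldhausenPairs`
(`X ↔ crux` is `agkCondition_iff_normalFormStablyTrivial`; this is its frequent form). [cite: AbramsGayKirby2018, Cor. 6] -/
theorem agkCondition_of_frequently_level (hW : WaldhausenPairs)
    (h : ∀ m₀ : ℕ, ∃ m, m₀ ≤ m ∧ ∀ K : TrisectionKernels (3 + 3 * m),
      IsGroupTrisection (3 + 3 * m) (m + 1) (PUnit : Type) K →
      (∀ i j : Fin 3, i ≠ j → ∃ α : SurfaceGroup (3 + 3 * m) ≃* SurfaceGroup (3 + 3 * m),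
        (s4Kernels.stabilizeIter m i).map α.toMonoidHom = K i ∧
        (s4Kernels.stabilizeIter m j).map α.toMonoidHom = K j) → K.IsStablyTrivial)
    (k : ℕ) (K : TrisectionKernels (3 * k)) (hK : IsGroupTrisection (3 * k) k (PUnit : Type) K) :
    K.IsStablyTrivial :=
  agkCondition_of_normalFormStablyTrivial hW (normalFormStablyTrivial_of_frequently hW h) k K hK

end Summit.SmoothPoincare4.SmoothPoincare4.Theorems.NormalFormStablyTrivial.Sketch

end
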